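import Literature.MathematicalPhysics.QuantumFieldTheory.Balaban1983to89.B10RunsOfRecord
import Literature.MathematicalPhysics.QuantumFieldTheory.Balaban1983to89.Node00.CarriersB10

/-!
# [Balaban1985UV3] (2) — «E6′ IN THE SLOT'S LETTERS»: exact Haar compatibility `Ū_*(dU) = dV` of an averaging map versus the versions of the
# renormalization transformation (10) along it — every version's `T 1` IS the density of `Ū_*(dU)`, so `Ū_*(dU) = dV ⟺ T 1 = 1` dV-a.e.; at print's
# averaging of the [B10] slot of record (`B10RunsOfRecord.avOfPrint`) the identity HOLDS beyond the standing range and IS the open question inside it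

KERNEL COMPANION (THEOREMS ONLY) to the located COUNT-PATH SEAM note `HOME(pub-ymgap)/pub-ymgap-dag-n08-a/N08-COUNT-PATH-SEAM-E6.md` (seat `pub-ymgap-dag-n08-a` g6,
2026-08-26; dag-lead WORD «WANTED» DEDUP-74; ref-C pre-read conditions (k1)–(k5)).  N08's slot of record `Node00.PrintedUV3V N L` quantifies ∃ over VERSIONS
`𝔗 : Node00.TFamily₃ N L` of print's transformations (2) = [Balaban1985Averaging] (10) along print's averaging `avOfPrint N S j` (Bałaban's block averaging
[Balaban1987RG1] (0.4) = the tree's reading of [Balaban1985Averaging] (15) in the standing range `j + 1 ≤ m + K`; the transport relabelling beyond it).  The d = 3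
lane's END architecture carries EXACT HAAR COMPATIBILITY of the averaging as an END input («E6′»; its one-direction letter is
`Summit.QuantumFields.Balaban3D.Proofs.Transport48.isRT_one_of_map`, which §1 generalises to an IFF in Literature letters; no lane file is imported or touched here).
WHAT PRINT SAYS (lit-balaban ME-11, pub-ymgap INBOX l.11584): an averaging is postulated to be gauge covariant ([Balaban1985Averaging] (11) p.19) and well approximated by
the linear average ((14) p.19), «many other definitions» being admissible ([Balaban1987RG1] p.254) — NO measure-theoretic axiom; [Balaban1985UV3] uses only the
total-mass identity `∫Tρ dV = ∫ρ dU` ((6) p.257, true for every `Ū`), the V-independent normalisation of [Balaban1987RG1] (0.17)∕(0.19) p.255 and the small-field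
change of variables (17) p.260; E6′ is NOT IN PRINT (locators as printed in that desk answer; not re-derived here).  §1 (any measurable averaging, any version `T : RTOpI`): `∫ T1 dV = 1`, `T 1` integrable, **`Ū_*(dU) = (T 1)·dV`**, hence `HaarAC` from the mere
existence of a version, all versions agree a.e. on `T 1`, and **`Ū_*(dU) = dV ⟺ T 1 =ᵐ 1`**.  §2 (at `avOfPrint` on SU(N)): measurability; BEYOND the standing range
E6′ HOLDS (relabelling, `AveragingRT.map_transportAvg`); at every level `Ū_*(dU) = dV ⟺ (𝔗 S j).T 1 =ᵐ 1` for EVERY family `𝔗`; inside the standing range the left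
side is VERBATIM `(avgFun expMeanLogSU)_*(dU) = dV`.  HONEST FRAMING: NOTHING is decided here about the truth of E6′ inside the standing range — that stays with
pub-balaban3d DEPMAP v6 §16 N22 (abelian true; direction-1 exact; d = 2 side-2 analogue numerically violated; d = 3 undecided), ME-11, and the chair's (R-·) species word;
nothing of Bałaban's asserted; N08 NOT discharged; count-neutral; nothing continuum ∕ OS ∕ mass gap ∕ Clay.  No `sorry` ∕ `def` ∕ `instance`; standard axioms.
-/

noncomputable section

open MeasureTheory

namespace Literature.MathematicalPhysics.QuantumFieldTheory.Balaban1983to89.B10Eq2HaarCompatibility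

open AveragingRT Balaban1985CMP102.Setting B10RunsOfRecord B10Eq2DensityTower

/-! ## §1. Any measurable averaging map, any version of (10) along it -/

section Generic

variable {P : Params} {j : ℕ} {G : Type*} [GaugeGroup G] [MeasurableSpace G] [HaarData G]
  {av : Averaging P j G}

/-- **`∫dV (T1)(V) = 1`** for every version of (10) along any averaging (`Setup.IsRT` at the constant test function). [cite: Balaban1985Averaging, (10) p.19; Balaban1985UV3, (6) p.257] -/
theorem integral_T_one (T : RTOpI P j G av) : ∫ V, T.T 1 V ∂(fieldMeasure P (j + 1) G) = 1 := by
  have h := T.isRT 1 (integrable_const _) (fun _ => (1 : ℝ)) measurable_const ⟨1, fun _ => by simp⟩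
  simpa using h

/-- **`T 1` is integrable** for every version (a Bochner integral equal to `1` is not a junk value). [cite: Balaban1985Averaging, (10) p.19 (bookkeeping)] -/
theorem integrable_T_one (T : RTOpI P j G av) : Integrable (T.T 1) (fieldMeasure P (j + 1) G) :=
  Integrable.of_integral_ne_zero (by rw [integral_T_one T]; exact one_ne_zero)

/-- `T 1 ≥ 0` pointwise (positivity clause of `RTOpI`). [cite: Balaban1985Averaging, (10) p.19 (bookkeeping)] -/
theorem T_one_nonneg (T : RTOpI P j G av) (V : GaugeField P (j + 1) G) : 0 ≤ T.T 1 V := T.pos 1 (fun _ => zero_le_one) V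

/-- **`∫_A dV (T1) = dU(Ū⁻¹ A)`** for every measurable `A`: the push-forward identity at the indicator of `A`. [cite: Balaban1985Averaging, (10) p.19] -/
theorem setIntegral_T_one (T : RTOpI P j G av) (havg : Measurable av.avg) {A : Set (GaugeField P (j + 1) G)} (hA : MeasurableSet A) :
    ∫ V in A, T.T 1 V ∂(fieldMeasure P (j + 1) G) = ((fieldMeasure P j G) (av.avg ⁻¹' A)).toReal := by
  have h := T.isRT 1 (integrable_const _) (A.indicator fun _ => (1 : ℝ)) (measurable_const.indicator hA)
    ⟨1, fun V => by by_cases hV : V ∈ A <;> simp [Set.indicator, hV]⟩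
  have hL : (fun V => T.T 1 V * A.indicator (fun _ => (1 : ℝ)) V) = A.indicator (T.T 1) := by
    funext V; by_cases hV : V ∈ A <;> simp [Set.indicator, hV]
  have hR : (fun U => (1 : Density P j G) U * A.indicator (fun _ => (1 : ℝ)) (av.avg U)) = (av.avg ⁻¹' A).indicator fun _ => (1 : ℝ) := by
    funext U; by_cases hU : av.avg U ∈ A <;> simp [Set.indicator, hU, Set.mem_preimage]
  rw [hL, hR, integral_indicator hA, integral_indicator (havg hA), setIntegral_const, smul_eq_mul, mul_one, measureReal_def] at h
  exact h

/-- **EVERY VERSION's `T 1` IS THE DENSITY OF THE IMAGE MEASURE: `Ū_*(dU) = (T 1) · dV`.** [cite: Balaban1985Averaging, (10) p.19 (the δ-formula read as a push-forward; bookkeeping)] -/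
theorem map_avg_eq_withDensity_T_one (T : RTOpI P j G av) (havg : Measurable av.avg) :
    (fieldMeasure P j G).map av.avg = (fieldMeasure P (j + 1) G).withDensity fun V => ENNReal.ofReal (T.T 1 V) := by
  ext A hA
  rw [Measure.map_apply havg hA, withDensity_apply _ hA,
    ← ofReal_integral_eq_lintegral_ofReal (integrable_T_one T).integrableOn (ae_of_all _ fun V => T_one_nonneg T V),
    setIntegral_T_one T havg hA, ENNReal.ofReal_toReal (measure_ne_top _ _)]

/-- **`HaarAC Ū` from the mere EXISTENCE of a version of (10) along `Ū`** (cf. `B10Eq2DensityTower.hac_expMeanLogSU_SUN`). [cite: Balaban1985Averaging, (10) p.19 (bookkeeping)] -/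
theorem haarAC_of_rtOpI (T : RTOpI P j G av) (havg : Measurable av.avg) : T4FiniteEpsInhabited.HaarAC av.avg := by
  show (fieldMeasure P j G).map av.avg ≪ fieldMeasure P (j + 1) G
  rw [map_avg_eq_withDensity_T_one T havg]
  exact withDensity_absolutelyContinuous _ _

/-- `ofReal ∘ T1` is a.e.-measurable with finite integral (plumbing). [cite: Balaban1985Averaging, (10) p.19 (bookkeeping)] -/
theorem aemeasurable_ofReal_T_one (T : RTOpI P j G av) :
    AEMeasurable (fun V => ENNReal.ofReal (T.T 1 V)) (fieldMeasure P (j + 1) G) ∧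
      ∫⁻ V, ENNReal.ofReal (T.T 1 V) ∂(fieldMeasure P (j + 1) G) ≠ ⊤ :=
  ⟨(integrable_T_one T).aestronglyMeasurable.aemeasurable.ennreal_ofReal,
    ((integrable_T_one T).lintegral_lt_top.trans_le le_top).ne⟩

/-- **All versions of (10) along one averaging agree dV-a.e. on `T 1`** (two densities of the same image measure). [cite: Balaban1985Averaging, (10) p.19 (bookkeeping)] -/
theorem T_one_ae_eq_of_versions (T T' : RTOpI P j G av) (havg : Measurable av.avg) :
    T.T 1 =ᵐ[fieldMeasure P (j + 1) G] T'.T 1 := by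
  have h : (fieldMeasure P (j + 1) G).withDensity (fun V => ENNReal.ofReal (T.T 1 V)) =
      (fieldMeasure P (j + 1) G).withDensity fun V => ENNReal.ofReal (T'.T 1 V) := by
    rw [← map_avg_eq_withDensity_T_one T havg, ← map_avg_eq_withDensity_T_one T' havg]
  have hae := (withDensity_eq_iff (aemeasurable_ofReal_T_one T).1 (aemeasurable_ofReal_T_one T').1 (aemeasurable_ofReal_T_one T).2).1 h
  filter_upwards [hae] with V hV
  have := congrArg ENNReal.toReal hV
  rwa [ENNReal.toReal_ofReal (T_one_nonneg T V), ENNReal.toReal_ofReal (T_one_nonneg T' V)] at this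

/-- **EXACT HAAR COMPATIBILITY ⟺ `T 1 = 1` a.e., FOR EVERY VERSION**: `Ū_*(dU) = dV ↔ T 1 =ᵐ[dV] 1`.  The left side is the d = 3 lane's END input
`Carriers.ExternalInputs.av_map` («E6′») at the averaging `Ū`; the right side is a property of ANY ONE version of (10) along `Ū`.
[cite: Balaban1985Averaging, (10) p.19; Balaban1985UV3, (2) p.256 (bookkeeping; the identity itself is NOT IN PRINT for (15))] -/
theorem map_avg_eq_iff_T_one_ae_eq_one (T : RTOpI P j G av) (havg : Measurable av.avg) :
    (fieldMeasure P j G).map av.avg = fieldMeasure P (j + 1) G ↔ T.T 1 =ᵐ[fieldMeasure P (j + 1) G] 1 := by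
  rw [map_avg_eq_withDensity_T_one T havg]
  have key : ((fieldMeasure P (j + 1) G).withDensity fun V => ENNReal.ofReal (T.T 1 V)) =
        (fieldMeasure P (j + 1) G).withDensity (fun _ => 1) ↔
      (fun V => ENNReal.ofReal (T.T 1 V)) =ᵐ[fieldMeasure P (j + 1) G] fun _ => 1 :=
    withDensity_eq_iff (aemeasurable_ofReal_T_one T).1 aemeasurable_const (aemeasurable_ofReal_T_one T).2
  have h1 : (fieldMeasure P (j + 1) G).withDensity (fun _ => (1 : ENNReal)) = fieldMeasure P (j + 1) G := withDensity_one
  rw [h1] at key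
  rw [key]
  refine ⟨fun h => ?_, fun h => ?_⟩
  · filter_upwards [h] with V hV
    exact ENNReal.ofReal_eq_one.1 hV
  · filter_upwards [h] with V hV
    show ENNReal.ofReal (T.T 1 V) = 1
    rw [hV]; simp

end Generic

/-! ## §2. At the [B10] slot's averaging `B10RunsOfRecord.avOfPrint N S j` on SU(N) -/

section Print

variable (N : ℕ) [NeZero N] {L : ℕ} (S : Scales L) (j : ℕ)

/-- Beyond the standing range print's averaging of record IS the transport relabelling. [cite: Balaban1985UV3, (2) p.256 (plumbing)] -/
theorem avOfPrint_avg_of_not_le (hj : ¬ j + 1 ≤ S.P.m + S.P.K) :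
    (avOfPrint N S j).avg = AveragingRT.transportAvg (P := S.P) (G := Node00.SU N) (show S.P.m + S.P.K ≤ j by omega) := by
  show (blockAvgStd S.P (Node00.SU N) ExpMeanLog.expMeanLogSU j).avg = _
  rw [blockAvgStd_of_not_le _ hj]
  simp only [AveragingRT.stdAvg, dif_neg hj]

/-- **Print's averaging of record is measurable at every level.** [cite: Balaban1987RG1, (0.4) p.253; Balaban1985Averaging, (15) p.19 (automatic, not in print)] -/
theorem measurable_avOfPrint : Measurable (avOfPrint N S j).avg := by
  by_cases hj : j + 1 ≤ S.P.m + S.P.K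
  · show Measurable (blockAvgStd S.P (Node00.SU N) ExpMeanLog.expMeanLogSU j).avg
    rw [blockAvgStd_avg_of_le _ hj]
    exact BlockAveraging.measurable_avgFun _ ExpMeanLog.measurable_expMeanLogSU_E
  · rw [avOfPrint_avg_of_not_le N S j hj]
    exact AveragingRT.measurable_transportAvg _

/-- **BEYOND THE STANDING RANGE E6′ HOLDS OUTRIGHT** (a relabelling is Haar compatible: `AveragingRT.map_transportAvg`). [cite: Balaban1985UV3, (2) p.256 (bookkeeping)] -/
theorem map_avOfPrint_eq_of_not_le (hj : ¬ j + 1 ≤ S.P.m + S.P.K) :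
    (fieldMeasure S.P j (Node00.SU N)).map (avOfPrint N S j).avg = fieldMeasure S.P (j + 1) (Node00.SU N) := by
  rw [avOfPrint_avg_of_not_le N S j hj]
  exact AveragingRT.map_transportAvg _

/-- … so beyond the standing range EVERY version of print's `T` fixes the constant density a.e. [cite: Balaban1985UV3, (2) p.256 (bookkeeping)] -/
theorem T_one_ae_eq_one_of_not_le (𝔗 : Node00.TFamily₃ N L) (hj : ¬ j + 1 ≤ S.P.m + S.P.K) :
    (𝔗 S j).T 1 =ᵐ[fieldMeasure S.P (j + 1) (Node00.SU N)] 1 :=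
  (map_avg_eq_iff_T_one_ae_eq_one (𝔗 S j) (measurable_avOfPrint N S j)).1 (map_avOfPrint_eq_of_not_le N S j hj)

/-- **E6′ AT THE SLOT'S AVERAGING, IN THE SLOT'S LETTERS, every level**: exact Haar compatibility of `avOfPrint N S j` ⟺ the version `𝔗 S j` of ANY transformation family
`𝔗 : Node00.TFamily₃ N L` fixes the constant density a.e. [cite: Balaban1985UV3, (2) p.256; Balaban1985Averaging, (10) + (15) p.19 (bookkeeping; NOT IN PRINT)] -/
theorem map_avOfPrint_eq_iff (𝔗 : Node00.TFamily₃ N L) :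
    (fieldMeasure S.P j (Node00.SU N)).map (avOfPrint N S j).avg = fieldMeasure S.P (j + 1) (Node00.SU N) ↔
      (𝔗 S j).T 1 =ᵐ[fieldMeasure S.P (j + 1) (Node00.SU N)] 1 :=
  map_avg_eq_iff_T_one_ae_eq_one (𝔗 S j) (measurable_avOfPrint N S j)

/-- **INSIDE THE STANDING RANGE THE QUESTION IS VERBATIM E6′ FOR BAŁABAN's BLOCK AVERAGING (0.4)∕(15) on SU(N)**:
`(avgFun expMeanLogSU)_*(dU) = dV ⟺ (𝔗 S j).T 1 = 1` a.e., for every transformation family of the slot.  Neither side is claimed (pub-balaban3d DEPMAP v6 §16 N22;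
the seat's SEAM note). [cite: Balaban1987RG1, (0.4) p.253; Balaban1985Averaging, (10) + (15) p.19 (NOT IN PRINT)] -/
theorem map_avOfPrint_eq_iff_of_le (𝔗 : Node00.TFamily₃ N L) (hj : j + 1 ≤ S.P.m + S.P.K) :
    (fieldMeasure S.P j (Node00.SU N)).map
        (BlockAveraging.avgFun ExpMeanLog.expMeanLogSU :
          GaugeField S.P j (Node00.SU N) → GaugeField S.P (j + 1) (Node00.SU N)) = fieldMeasure S.P (j + 1) (Node00.SU N) ↔
      (𝔗 S j).T 1 =ᵐ[fieldMeasure S.P (j + 1) (Node00.SU N)] 1 := by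
  rw [← map_avOfPrint_eq_iff N S j 𝔗]
  show _ ↔ (fieldMeasure S.P j (Node00.SU N)).map (blockAvgStd S.P (Node00.SU N) ExpMeanLog.expMeanLogSU j).avg = _
  rw [blockAvgStd_avg_of_le _ hj]

/-- All transformation families of the slot agree a.e. on `T 1` («some version fixes 1» = «every version fixes 1»). [cite: Balaban1985Averaging, (10) p.19 (bookkeeping)] -/
theorem T_one_ae_eq_of_families (𝔗 𝔗' : Node00.TFamily₃ N L) :
    (𝔗 S j).T 1 =ᵐ[fieldMeasure S.P (j + 1) (Node00.SU N)] (𝔗' S j).T 1 :=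
  T_one_ae_eq_of_versions (𝔗 S j) (𝔗' S j) (measurable_avOfPrint N S j)

end Print

end Literature.MathematicalPhysics.QuantumFieldTheory.Balaban1983to89.B10Eq2HaarCompatibility

end
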